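import Summits.BirchSwinnertonDyer.BirchSwinnertonDyer.Theorems.Rank1ResidualX9Defs
import HarnessLib
import HarnessLib.Audit

/-!
# Kato's INTEGRAL divisibility on class X9 (irreducible, NON-surjective image) — the cell's candidate
# es-C1 / C-imc-1, filed as an OPEN obligation node (`@[conjecture] def`); nothing asserted

HONEST FRAMING (cell `bsd-f3-mu`, D-0131 (3) FRONTIER TIER, HOME `run/shared/lean/pub/bsd-f3-mu/`;
charter: «by what mechanism is `μ(L_p(E)) = 0 = μ(Sel)` when `ρ̄_{E,p}` is irreducible but not
surjective (X9: `5Ns`, `5S4`, `7Ns`; X10b: `3Ns`, `3Nn`), and can Greenberg–Vatsal congruence transfer be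
made image-free?»).  This file is the TYPER's filing of the ONE candidate statement that survived the
cell's first refuter pass (2026-08-27): it is a pure CONJECTURE LEAF — only `@[conjecture] def`s, no
theorem, nothing about any curve asserted, typed ≠ proved ≠ endorsed — so that routes, idea cards and
Literature theorems "assuming C1" can name it (`--conditional-on KatoDivisibilityOnClassX9`); the
kernel edges (equivalence with the exponent form, the four-twist squeeze to
`IntegralMainConjectureOnClassX9` / `BSDpOnClassX9`, the relation to items 19629 / 19630) live in the
sibling `KatoDivisibilityEdges.lean`, and a future `_holds` goes in a sibling file, never here.

## Provenance (cell record; every sentence has a file of record in HOME)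

* MEMO-es.md §3 (planner `-es`, 2026-08-27T13:30Z; `HOME/es/Sketch.lean` sha16 5c6ff41bbbdd79bd, rc 0):
  candidate **C1 `KatoDivisibilityOnClassX9`** — "Kato Astérisque 295 Thm 17.4(3)'s conclusion
  `L_p(f, α_p) ∈ ι(char_Λ X(E/ℚ_∞))` with «ρ_{E,p^∞} surjective» replaced by ClassX9"; **C1⁺
  `KatoDivisibilityIrreducible`** — the same at every `p ≥ 5` good ordinary with `E[p]` irreducible.
* MEMO-imc.md §3 (planner of record `-imc`, 13:27Z; `HOME/imc/Sketch.lean` sha16 a269a77c30810761, rc 0):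
  **C-imc-1 `KatoOneSidedMuOnClassX9`** (`k ≤ 0` in the exponent currency of BCS 2025 Thm 1.1.2 (a):
  `ch X = (g)`, `ι g = p^k L_p`) — KERNEL-EQUIVALENT to C1 (`katoOneSided_of_katoDivisibility`, Rohrlich
  only; converse with BCS (a)) — and the mirror **C-imc-2 `EisensteinOneSidedMuOnClassX9`** (`k ≥ 0`).
  «One crux, two typings; the cell should carry ONE name (es-C1).»
* REF1-AUDIT.md §3.1 (refuter `-ref1`, 13:33Z): es-C1 **SURVIVES** (rc 0, triviality fails, BC7
  `#h21_crux_probe … summit := BSDpOnClassX9` CLEAN, non-vacuous — 790 census pairs inhabit the scope, `X`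
  is `Λ`-torsion there by BCS (a) clause 1 so the `D.charIdeal` junk reading is unrealised); C-imc-1
  SURVIVES (= es-C1); C1⁺ **SURVIVES-NARROWED** («scope contains CM split-ordinary pairs, e.g. 27a1 @ 7;
  repair: add `¬ W.HasCM`» — done below, `KatoDivisibilityIrreducibleNonCM`); C-imc-2
  **SURVIVES-WEAK** (implied by item 19630 `AnalyticMuZeroOnClassX9`: ref1's kernel lemma
  `eisensteinOneSided_of_analyticMuZero`, HOME/ref1/ImcProbe.lean).
* REF2-LITMAP.md §3 (refuter `-ref2`, 13:29Z): es-C1 / C-imc-1 **OPEN — class-wide in no printed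
  theorem** [BurungaleCastellaSkinner2025 display (5.4) «in `Λ` if hypothesis (im) holds, and in
  `Λ ⊗ ℚ_p` otherwise», arXiv:2405.00270v2 p. 10 L93–99; Kato2004Asterisque Thm 17.4 (3) (surjective
  image); Wuthrich2014 Cor. 19 «semistable can not be dropped … normaliser of a non-split Cartan»;
  Kim–Kim–Sun 2020 (Im)]; NAMED open and CONDITIONALLY in print: Wuthrich2006 (MRL 13) Thm 2 + Lemma 3 /
  Thm 4, Prop. 7 p. 717: Conj A(E, p) ⟹ `k ≤ 0`, image-free; C-imc-2 OPEN off the certified pairs.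
* BC5 witness (MEMO-es §4 / MEMO-imc §5): on every row of the census of record with a two-engine
  `μ(L_p) = 0` certificate (`bsd-smallim/k6fin/pkg/data/k6fin_unitcoeff_cert.tsv` sha16 dde28b2c4045f536:
  790/790; book230 250/250; N3 31; the cell's X9-MU-TABLE-v1 when it lands) C1 is DECIDED TRUE modulo F1
  (19629) + BCS (a); cheapest falsifier RUN (`HOME/es/falsifier_c1.py`, < 1 CPU-s): rows with `μ_an ≥ 1`
  0/790 (C1 never enters its open regime on the census), `λ_an ≥ r + dim Ш[p]_an` 0 violations/790
  (14/14 rows with `p² ∣ #Ш_an` have `λ_an = r + 2` exactly), parity 0/790.  Column that would refute: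
  `sel_p_rank > lambda_an` at a row with `μ_an = 0` (two engines).
* Why novel (planners' sentence): «C1 is the exact output type of any τ-free Euler/Kolyvagin-system
  argument at small image, kernel-replaces 19629 in the X9 assembly, is class-wide equivalent to
  `IntegralMainConjectureOnClassX9` by the four-twist squeeze through BCS's PRINTED integral display
  (5.3) with NO analytic `μ = 0` input, and carries a data falsifier (`λ_an ≥ s_p`) the `μ`-nodes do
  not» (MEMO-es §6, MEMO-imc §6; honest grade: new NODE + certified reduction, not a new mechanism).

## The statements (verbatim the audited Sketch texts; tree vocabulary only — TYPING-KIT v1.2)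

* `KatoDivisibilityOnClassX9` — for every X9 pair `(W, p)` (`Rank1ResidualX9Defs.ClassX9`: non-CM,
  `p ≥ 5` good ordinary, `E[p]` irreducible, `ρ̄_{E,p}` not surjective), all cyclotomic data `(κ, γ)`,
  every newform `f` of `W` (any level) and every dual Selmer datum `D` (`D.X = X(E/ℚ_∞)`):
  `∃ g ∈ D.charIdeal, ι g = L_p(f, unitRoot W p)`.  Per pair this is the Literature carrier
  `Rank1Residual.KatoDivisibilityAt W p` (`MuLambdaCarriers.lean` §3) and, granted BCS (a), the
  exponent form `MuDefectNonposAt W p` (`k ≤ 0`); the edges file proves both readings.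
* `KatoDivisibilityIrreducibleNonCM` — the same conclusion at every NON-CM `W`, `p ≥ 5` good ordinary,
  `E[p]` irreducible, ANY image (binders of `KatoMuTransfer` minus the certificate, plus `¬ W.HasCM` per
  ref1): on the surjective locus it is clause 3 of the tree fact `kato_divisibility` (Kato 17.4 (3),
  PRINTED), off it exactly `KatoDivisibilityOnClassX9`; the natural output type of "thread (iii)".
* `EisensteinOneSidedMuOnClassX9` — the mirror `0 ≤ k` at every X9 pair (one-curve Eisenstein lower
  bound); DOMINATED by item 19630 (ref1) and not proposed for staffing (MEMO-imc §3); filed so that the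
  defect `k` has both one-sided nodes by name.

Not filed as nodes (and why, cell record): C1μ `MuAlgLeMuAnOnClassX9` (ref1: SURVIVES-REDUNDANT, ≡ C1
mod BCS (a) — one name); T2′ `TwistDivisibilityTransfer` (ref1/ref2: NOT A CANDIDATE — it is the
squeeze THEOREM, `KatoDivisibilityEdges.lean`); `KatoOneSidedMuOnClassX9` (≡ C1 — one name; its
per-pair body is the carrier `MuDefectNonposAt`).

References: [Kato2004Asterisque] Thm. 17.4 (3), Thm. 12.5 (4) with (12.5.2); [BurungaleCastellaSkinner2025]
Thm. 1.1.2, (im) p. 2, displays (5.3)–(5.4) p. 10; [Wuthrich2006] Thm. 2, Prop. 7 (p. 717); [Wuthrich2014]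
Cor. 19; HOME MEMO-es.md, MEMO-imc.md, REF1-AUDIT.md §3.1, REF2-LITMAP.md §3, CANDIDATES.md §1.
-/

-- the summit and its single problem are both named `BirchSwinnertonDyer` (registry layout D-0017):
-- the X9 class predicate lives in `Summit.BirchSwinnertonDyer.BirchSwinnertonDyer.Rank1Residual`
set_option linter.dupNamespace false

noncomputable section

open scoped Classical MatrixGroups ModularForm

open CongruenceSubgroup WeierstrassCurve Literature.NumberTheory.EllipticCurves
  Literature.NumberTheory.EllipticCurves.ModularForms
  Summit.BirchSwinnertonDyer.BirchSwinnertonDyer.Rank1Residual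

namespace Summit.BirchSwinnertonDyer.Rank1Residual.SmallImageMu

/-- **es-C1 / C-imc-1 — Kato's integral divisibility on class X9 (OPEN; cell candidate, refuter-cleared
2026-08-27; nothing asserted).**  For every X9 pair `(E, p)` (`ClassX9 W p`: no CM, `p ≥ 5` good
ordinary, `E[p]` irreducible and NOT surjective), the cyclotomic `ℤ_p`-extension `κ` with topological
generator `γ` matching the cyclotomic variable, a newform `f` of `E` and every dual Selmer datum `D`
(`D.X = X(E/ℚ_∞)`): `L_p(f, α_p) ∈ ι(char_Λ X(E/ℚ_∞))`, i.e. `∃ g ∈ char_Λ X, ι g = L_p(f, α)`.  This is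
the CONCLUSION of Kato, Astérisque 295, Thm. 17.4 (3) with its image hypothesis («`ρ_{E,p^∞}`
surjective», (12.5.2)) replaced by the X9 scope — where that hypothesis, and BCS 2025's (im), FAIL
(`Rank1Residual.not_bcsHypothesisIm_of_classX9`).  Equivalently (edges file, Rohrlich / BCS (a)) the
`μ`-defect `k(E,p) = μ(X) − μ(L_p)` is `≤ 0` at every X9 pair.  OPEN in print: BCS 2025 display (5.4)
is «in `Λ` if hypothesis (im) holds, and in `Λ ⊗ ℚ_p` otherwise»; conditionally (Conj A ⟹ `k ≤ 0`)
Wuthrich 2006 Thm 2 / Prop 7.  Verbatim the audited text of `HOME/es/Sketch.lean` (binder order kept).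
[cite: Kato2004Asterisque, Thm. 17.4 (3) (p. 273) — conclusion stated there under surjectivity; OPEN on X9]
[cite: BurungaleCastellaSkinner2025, display (5.4) and hypothesis (im) (pp. 2, 10 of arXiv:2405.00270v2)]
[cite: Wuthrich2006, Thm. 2 and Prop. 7 (p. 717) — the conditional form] -/
@[conjecture] def KatoDivisibilityOnClassX9 : Prop :=
  ∀ (W : WeierstrassCurve ℚ) [W.IsElliptic] [W.IsGloballyMinimal] (p : ℕ) [Fact p.Prime]
    (κ : ZpExtension ℚ p) (γ : Field.absoluteGaloisGroup ℚ)
    {N : ℕ} [NeZero N] (f : CuspForm (Gamma0 N) 2)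
    (_hX9 : ClassX9 W p) (_hκ : κ.IsCyclotomic) (_hγ : κ.IsTopGenerator γ)
    (_hγ' : IsCyclotomicVariable p γ) (_hf : IsNewformOf W f)
    (D : W.SelmerDualData κ γ),
    ∃ g ∈ D.charIdeal,
      iwasawaToPowerSeries p g = padicLFunction f (unitRoot W p : ℚ_[p])

/-- **es-C1⁺ (narrowed per ref1) — Kato's integral divisibility at every irreducible good ordinary
`p ≥ 5` of a NON-CM curve, ANY image (OPEN off the surjective locus; nothing asserted).**  Binders =
those of `Rank1Residual.KatoMuTransfer` (item 19629) minus the analytic certificate, plus `¬ W.HasCM`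
(ref1: without it the scope contains CM split-ordinary pairs, e.g. `27a1 @ 7`, where the statement is
Rubin's theorem, not Kato's); conclusion as in `KatoDivisibilityOnClassX9`.  On the surjective locus
(`p ≥ 5`: mod-`p` surjective ⟹ `p`-adically surjective, Serre) it is clause 3 of the PUBLISHED tree
fact `kato_divisibility` (Kato Thm. 17.4 (3)); its complement in the scope is exactly class X9, so
C1⁺ = (Kato 17.4 (3) in print) ∧ `KatoDivisibilityOnClassX9` (edge `katoDivisibilityOnClassX9_of_irreducibleNonCM`).
[cite: Kato2004Asterisque, Thm. 17.4 (3) (p. 273) — printed on the surjective locus; OPEN off it] -/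
@[conjecture] def KatoDivisibilityIrreducibleNonCM : Prop :=
  ∀ (W : WeierstrassCurve ℚ) [W.IsElliptic] [W.IsGloballyMinimal] (p : ℕ) [Fact p.Prime]
    {N : ℕ} [NeZero N] (f : CuspForm (Gamma0 N) 2),
    5 ≤ p → W.HasGoodReductionAtPrime p → ¬ (p : ℤ) ∣ W.frobeniusTrace p →
    W.HasIrreducibleModPGaloisRep p → ¬ W.HasCM → IsNewformOf W f →
    ∀ (κ : ZpExtension ℚ p) (γ : Field.absoluteGaloisGroup ℚ),
      κ.IsCyclotomic → κ.IsTopGenerator γ → IsCyclotomicVariable p γ →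
      ∀ D : W.SelmerDualData κ γ,
        ∃ g ∈ D.charIdeal,
          iwasawaToPowerSeries p g = padicLFunction f (unitRoot W p : ℚ_[p])

/-- **C-imc-2 — the one-curve Eisenstein inequality on class X9 (OPEN off the certified pairs;
DOMINATED by item 19630; not proposed for staffing; nothing asserted).**  For every X9 pair, all
cyclotomic data, every newform `f`, every dual datum `D` and every `g ∈ Λ`, `k ∈ ℤ` with
`ch_Λ X = (g)` and `ι g = p^k · L_p(f, α)` (the exponent of BCS 2025 Thm. 1.1.2 (a)): `0 ≤ k`, i.e.
`μ(L_p(E)) ≤ μ(X(E/ℚ_∞))`.  Every printed Eisenstein lower bound at an irreducible prime is for a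
PRODUCT over a quadratic-twist orbit (Skinner–Urban 2014 Thm. 3.29 via `K`, needing (ram) — false on X9;
BCS 2025 (5.3) via `FK`), never for one curve; item 19630 (`μ(L_p) = 0`) implies it trivially (ref1's
kernel lemma).  Per pair this is the Literature carrier `Rank1Residual.MuDefectNonnegAt W p`; the body is
spelled out here verbatim from `HOME/imc/Sketch.lean`.
[cite: SkinnerUrban2014, Thm. 3.29 — the orbit-product lower bound; one curve OPEN]
[cite: BurungaleCastellaSkinner2025, display (5.3) (p. 10 of arXiv:2405.00270v2)] -/
@[conjecture] def EisensteinOneSidedMuOnClassX9 : Prop :=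
  ∀ (W : WeierstrassCurve ℚ) [W.IsElliptic] [W.IsGloballyMinimal] (p : ℕ) [Fact p.Prime],
    ClassX9 W p →
    ∀ (κ : ZpExtension ℚ p) (γ : Field.absoluteGaloisGroup ℚ) {N : ℕ} [NeZero N]
      (f : CuspForm (Gamma0 N) 2),
      κ.IsCyclotomic → κ.IsTopGenerator γ → IsCyclotomicVariable p γ → IsNewformOf W f →
      ∀ (D : W.SelmerDualData κ γ) (g : IwasawaAlgebra p) (k : ℤ),
        D.charIdeal = Ideal.span {g} →
        iwasawaToPowerSeries p g =
          PowerSeries.C ((p : ℚ_[p]) ^ k) * padicLFunction f (unitRoot W p : ℚ_[p]) →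
        0 ≤ k

end Summit.BirchSwinnertonDyer.Rank1Residual.SmallImageMu

end
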